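import Mathlib.RingTheory.MvPolynomial.Basic
import Mathlib.RingTheory.MvPolynomial.Homogeneous
import Mathlib.Algebra.MvPolynomial.Funext
import Mathlib.Data.Finsupp.Multiset
import Mathlib.Data.Sym.Card
import Mathlib.RepresentationTheory.Basic
import Literature.Barriers.ValiantsHypothesis.AlgebraicNaturalProofs
import Literature.Computability.AlgebraicComplexity.ValiantClasses
import Literature.Computability.AlgebraicComplexity.DeterminantalComplexityProofs
import Literature.Computability.Complexity.CNF
import HarnessLib

/-!
# Grochow–Kumar–Saks–Saraf 2017, *Towards an algebraic natural proofs barrier via polynomial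
# identity testing* (arXiv:1701.01717 = ECCC TR17-009) — the CLASS-LEVEL statements, as printed
# (cell val-lit, typer t19; source `paper:arxiv-1701.01717`, chunks p0005–p0010; bib
# `GrochowKumarSaksSaraf2017`)

Companion to `AlgebraicNaturalProofs.lean`, which formalises the Forbes–Shpilka–Volk frame at ONE
level `n` (FSV Def. 1 `IsNaturalProof`, Def. 3 `IsSuccinctHittingSet`, Thm. 4
`exists_isNaturalProof_iff`, and the concrete classes `SmallCircuits` / `Distinguishers` /
`SuccinctHittingSetsForVP` = FSV Question 6) and cites this paper only for its abstract. GKSS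
phrase the same barrier for whole COMPLEXITY CLASSES of polynomial families ("reverse the order of
quantifiers", §2): a class is presented by a family of level sets `(ℱ_n)`, distinguishers
("meta-polynomials") form a *stretched* class `Γ(N)` measured in the number `N` of coefficients,
and Theorem 1 is the class-level form of FSV Thm. 4. This file types §2–§4 in that vocabulary, on
top of the tree's `PolyFamily k`, `VP k`, `VNP k`, `IsPBounded`, `complexity`, `HasDetRepr`,
`coeffVector`, and proves what is provable from the definitions (Theorem 1, the easy half of
Def. 2 ⟺ Def. 2′, the §4.1 and §4.2 observations, the count `N = binom(d+v-1, d)`).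

**Printed items and where they land** (locators `pNNNN.txt:Ln` = `lit read arxiv:1701.01717` chunk files;
`p.N` in the cite tags = page of the arXiv PDF, per the cell's `lit/pdftxt/GKSS2017/INDEX.tsv`).
* §2 preliminaries (p0005:L3–L7): p-bounded, p-family, `VP`, `VNP` are the tree's `IsPBounded`,
  `IsPFamily`, `VP k`, `VNP k` [`ValiantClasses.lean`]; GKSS's (affine) projections and
  p-projections → `IsAffineProjection`, `IsPAffineProjection` (Valiant's variable-or-constant
  projections `IsProjection` are a special case, `isAffineProjection_of_isProjection`).
* §2 Def. 1 "captures" / "captures with padding" (p0005:L19–L28) → `Captures`,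
  `CapturesWithPadding`; the level families `𝒟_n`, `𝒟ʰ_n`, `𝒮𝒫𝒮_n` (p0005:L13, L32, L40) →
  `detSet`, `detSetHom`, `spsSet`; the class `VP_ws` as defined there (p0005:L5) → `VPws`.
  (`𝒲_n`, weakly-skew circuits of size `≤ n`, p0005:L46, is NOT typed: the tree has no
  weakly-skew circuit model.)
* §2.1 meta-polynomials: `T(coeff f)` is the tree's `eval (coeffVector M f) T`
  [`AlgebraicNaturalProofs.lean`]; the count `N = binom(d_n + v_n - 1, d_n)` of degree-`d`
  monomials in `v` variables (p0006:L1) → `homMonomials`, `ncard_homMonomials` (proved).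
  Def. 2 stretched classes `𝒞(N)` (p0006:L10) → `PolyFamily.reindex`, `stretch`; Def. 2′
  (p0006:L15) for `VP` → `IsPBoundedIn`, `VPStretch`, with the printed equivalence
  Def. 2 ⟺ Def. 2′ proved for injective `N` (`stretch_VP_subset_VPStretch`,
  `VPStretch_subset_stretch_VP`, `stretch_VP_eq_VPStretch`); the meta-level instances `VP(N)`,
  `VP_ws(N)` at `N_n = |M_n|` → `VPMeta`, `VPwsMeta`.
* §3 Def. 3 natural property (p0007:L5) → `IsNaturalProperty`; Remarks 1–2 (p0007:L14, L19) in
  docstrings; Def. 4 `Γ`-natural against `Λ` (p0007:L24) → `IsNaturalAgainst`; Def. 5 succinct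
  hitting set (p0007:L39) → `IsSuccinctHittingSetFor` (for a fixed presentation `Λ(n)`) and
  `IsSuccinctHittingSetAgainst` (class level, "there is a family of sets `Λ(n)` which captures
  `Λ`"); **Thm. 1** (p0007:L42) → `isSuccinctHittingSetFor_iff_not_exists_isNaturalAgainst`
  (PROVED; load-bearing); Open Question 1 (p0008:L5) → `openQuestion1_VP`, `openQuestion1_VPws`,
  and the sentence after it → `question_VNP_VPws` (QUESTIONS, neutral `Prop`s, never asserted);
  Remark 3 generators (p0008:L10) = the tree's `IsHittingSetGenerator`
  [`AlgebraicNaturalProofsGenerators.lean`], docstring only.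
* §4.1 test `G`-modules (p0009:L5) → `IsTestModule`; the observation before Open Question 2
  (p0009:L11) → `exists_not_vanishing_of_testModule` (proved); Open Question 2 (p0009:L13) →
  `easiestComplexity` (the quantity asked for) and `HasTestFamilyIn` (its yes/no form).
* §4.2 Definition (Geometric IPS, [GP]) (p0010:L3) → `IsGeometricIPSCertificate`,
  `HasGeometricIPSProof`; its soundness (p0010:L12, [GP]) → `not_exists_commonZero_of_certificate`
  (proved); the 3CNF translation (p0010:L12) → `literalFactor`, `clauseEq`, `boolAxiom`,
  `cnfEquations`, with `eval_clauseEq_eq_zero_iff` and `cnf_satisfiable_iff_exists_commonZero`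
  (proved); the hitting-set observation (p0010:L16–L22) → `ImageHits`,
  `not_hasGeometricIPSProof_of_imageHits` (proved); Open Question 3 (p0010:L24) →
  `openQuestion3`; Open Question 4 (p0010:L31, "find and exploit an analogous connection … and
  (general) IPS") is not a mathematical statement and is recorded here only.

**Reading conventions made explicit (the paper: "the latter is not a precise, formal definition,
but in practice this will cause us no difficulties", §3).**
1. *A class is its presentation.* "Throughout, whenever we refer to a complexity class such as
   `VP_ws(n)`, we really mean `ℱ_n`, for any fixed family `ℱ_n` that captures `VP_ws`" (§2,
   p0005:L52). Accordingly Defs. 4–5 and Thm. 1 are typed for a PRESENTATION: level sets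
   `Λ n ⊆ k[x_1, …, x_{v n}]` on the simple side, and on the constructive side a set `Γ` of
   meta-polynomial FAMILIES `T = (T_n)`, `T_n ∈ k[{c_m}_{m ∈ M n}]` (the stretched class `Γ(N)`
   at `N_n = |M n|`, e.g. `VPMeta k v M`). The class-level Def. 5 (`IsSuccinctHittingSetAgainst`)
   quantifies over presentations exactly as printed ("there is a family of sets `Λ(n)` which
   captures `Λ`").
2. *Asymptotic membership.* "`(f_n)` is not contained in `Λ`" (Def. 4, usefulness) is read as
   "`f_n ∉ Λ(n)` for infinitely many `n`", and "hitting set against `Γ(N)`" (Def. 5) as "every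
   nowhere-zero `T ∈ Γ` is hit at all sufficiently large `n`". The literal all-`n` reading would
   make Def. 5 trivially FALSE for every presentation of `VP` (a `poly(N)` bound with its additive
   constant constrains `T_n` at no single level `n`, and at each level some nonzero meta-polynomial
   vanishes on the small-dimensional set `coeff(Λ(n))`), so it is not the authors' meaning; with
   the asymptotic reading Thm. 1 is a theorem (proved below over any infinite integral domain) and
   Open Question 1 is neither trivially true nor trivially false.
3. *Largeness.* "`C_n^*` is the complement of the zero-set of a meta-polynomial `T_n`" is typed
   with `T_n ≠ 0` at every `n` (a Zariski-open DENSE core; with `T_n = 0` the core is empty and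
   "largeness" says nothing), and "nonzero `T ∈ Γ(N)`" in Def. 5 as `∀ n, T_n ≠ 0`.
4. *Padding.* The linear forms `ℓ_n` of Def. 1 (2′) are nonzero (`ℓ = 0` would make (2′)
   vacuous as soon as `0 ∈ ℱ_m`; GCT padding multiplies by a power of a variable).
5. As in `AlgebraicNaturalProofs.lean`, "`C_n ⊆ Poly^{d_n}(v_n)`" is not imposed: `coeffVector M`
   projects any polynomial onto its `M`-coefficients (harmless generalisation, FSV file §Framework).

**Relation to the tree's FSV formalisation.** `SuccinctHittingSetsForVP F` (FSV Question 6) fixes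
the ambient `k[x_1..x_n]^{≤ n}` and reads "∀ distinguisher exponent `a` ∃ size exponent `b`,
eventually"; GKSS Open Question 1 (`openQuestion1_VP`) reads "∃ ONE capturing presentation of `VP`
hitting every `VP(N)` family, eventually per family". Neither implication between the two typed
statements is claimed here (different quantifier structure and ambient); the `VP_ws` half is the
neighbourhood of the route item `SuccinctHittingSetsForVBP` (Summits side, not importable here).
Honest framing: typed literature; `VP ≠ VNP` is open and nothing in this file bears on its truth.

## References
* [GrochowKumarSaksSaraf2017] J. A. Grochow, M. Kumar, M. Saks, S. Saraf, *Towards an algebraic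
  natural proofs barrier via polynomial identity testing*, arXiv:1701.01717 (2017), §2 (Def. 1–2),
  §3 (Def. 3–5, Thm. 1, Remarks 1–3, Open Question 1), §4.1 (Open Question 2), §4.2 (Definition
  of Geometric IPS after [GP], Open Questions 3–4).
* [ForbesShpilkaVolk2018] M. A. Forbes, A. Shpilka, B. L. Volk, Theory Comput. 14 (2018), Def. 1,
  Def. 3, Thm. 4 (the level-`n` frame this file builds on).
* [GrochowPitassi2018] J. A. Grochow, T. Pitassi, J. ACM 65 (2018) (= [GP], FOCS 2014): the
  Ideal Proof System and its geometric variant (cited through GKSS §4.2).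
* [Burgisser2000] P. Bürgisser, *Completeness and Reduction in Algebraic Complexity Theory*
  (the tree's `VP`, `VNP`, `IsPBounded`, `PolyFamily`).
-/

noncomputable section

namespace Literature.Barriers.ValiantsHypothesis.GKSS2017

open Literature.Computability.AlgebraicComplexity MvPolynomial
open Literature.Barriers.ValiantsHypothesis (coeffVector coeffVector_apply)

section Helpers

variable {k : Type*} [CommSemiring k]

/-- A variable has total degree at most `1` (exactly `1` over a nontrivial ring). [folklore] -/
private theorem totalDegree_X_le_one {σ : Type*} (i : σ) :
    (X i : MvPolynomial σ k).totalDegree ≤ 1 :=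
  (totalDegree_monomial_le _ _).trans (by simp)

end Helpers

/-! ### §2 Preliminaries: (affine) projections and p-projections as used by GKSS -/

section Projections

variable (k : Type*) [CommSemiring k]

/-- **Projection in the sense of GKSS §2**: "`f(x_1, …, x_n)` is a projection of `g(y_1, …, y_m)`
if there are affine linear functions `ℓ_1(x), …, ℓ_m(x)` such that `f(x) = g(ℓ_1(x), …, ℓ_m(x))`"
— an AFFINE projection (substitution of polynomials of total degree `≤ 1`), more permissive than
Valiant's variable-or-constant projection (the tree's `IsProjection`, see
`isAffineProjection_of_isProjection`). p-bounded, p-family, `VP`, `VNP` of the same paragraph are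
the tree's `IsPBounded`, `IsPFamily`, `VP`, `VNP` (GKSS's "for all sufficiently large `n`" in
p-boundedness is equivalent to the tree's "for all `n`" by enlarging the constant).
[cite: GrochowKumarSaksSaraf2017, §2 (projections), p.4] locator: paper:arxiv-1701.01717 p0005.txt:L7 -/
def IsAffineProjection {σ τ : Type*} (f : MvPolynomial τ k) (g : MvPolynomial σ k) : Prop :=
  ∃ ℓ : σ → MvPolynomial τ k, (∀ i, (ℓ i).totalDegree ≤ 1) ∧ f = aeval ℓ g

/-- **p-projection in the sense of GKSS §2**: "`f = (f_n)` is a p-projection of `g = (g_n)` if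
there is a polynomial `t(n)` such that for all `n`, `f_n` is a projection of `g_{t(n)}`" (affine
projections; `t` p-bounded). [cite: GrochowKumarSaksSaraf2017, §2 (p-projections), p.4] locator: paper:arxiv-1701.01717 p0005.txt:L7 -/
def IsPAffineProjection (f g : PolyFamily k) : Prop :=
  ∃ t : ℕ → ℕ, IsPBounded t ∧ ∀ n, IsAffineProjection k (f.poly n) (g.poly (t n))

variable {k}

/-- A Valiant projection (variables or constants substituted; the tree's `IsProjection`) is a
projection in GKSS's affine sense. [cite: GrochowKumarSaksSaraf2017, §2 (projections), p.4] locator: paper:arxiv-1701.01717 p0005.txt:L7 -/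
theorem isAffineProjection_of_isProjection {σ τ : Type*} {f : MvPolynomial τ k}
    {g : MvPolynomial σ k} (h : IsProjection f g) : IsAffineProjection k f g := by
  obtain ⟨a, ha, rfl⟩ := h
  refine ⟨a, fun i => ?_, rfl⟩
  rcases ha i with ⟨j, hj⟩ | ⟨c, hc⟩
  · rw [hj]; exact totalDegree_X_le_one j
  · rw [hc, totalDegree_C]; exact Nat.zero_le _

end Projections

/-! ### §2 Preliminaries: presentations of a class by level sets (Def. 1) -/

section Captures

variable (k : Type*) [CommSemiring k]

/-- **GKSS Def. 1 (captures).** A family of level sets `ℱ = (ℱ_n)`, `ℱ_n` a set of polynomials in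
the `v n` variables `x_0, …, x_{v n - 1}` (print: `ℱ_n ⊆ Poly^{d(n)}(v(n))`), *captures* the class
`𝒞` (a set of polynomial families, the tree's `PolyFamily k`) if (1) every family `(f_n)` with
`f_n ∈ ℱ_n` for all `n` lies in `𝒞`, and (2) for every `F ∈ 𝒞` there is a p-bounded `m` with
`F_n ∈ ℱ_{m n}` for every `n` — where, as usual, a polynomial in fewer variables is regarded as
one in the `v (m n)` ambient variables along an injective renaming `ι`.
[cite: GrochowKumarSaksSaraf2017, Def. 1, p.5] locator: paper:arxiv-1701.01717 p0005.txt:L19 -/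
def Captures (v : ℕ → ℕ) (ℱ : ∀ n, Set (MvPolynomial (Fin (v n)) k))
    (𝒞 : Set (PolyFamily k)) : Prop :=
  (∀ f : ∀ n, MvPolynomial (Fin (v n)) k, (∀ n, f n ∈ ℱ n) → (⟨v, f⟩ : PolyFamily k) ∈ 𝒞) ∧
    ∀ F ∈ 𝒞, ∃ m : ℕ → ℕ, IsPBounded m ∧
      ∀ n, ∃ ι : Fin (F.nvars n) → Fin (v (m n)),
        Function.Injective ι ∧ rename ι (F.poly n) ∈ ℱ (m n)

/-- **GKSS Def. 1, variant (captures with padding).** Condition (2) is replaced by (2′): there are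
p-bounded `e, m` and NONZERO linear forms `ℓ_n` (homogeneous of degree `1` in the ambient
variables; see the module docstring, reading convention 4) with `ℓ_n^{e n} · F_n ∈ ℱ_{m n}` for
every `n`. [cite: GrochowKumarSaksSaraf2017, Def. 1 (2′), p.5] locator: paper:arxiv-1701.01717 p0005.txt:L26 -/
def CapturesWithPadding (v : ℕ → ℕ) (ℱ : ∀ n, Set (MvPolynomial (Fin (v n)) k))
    (𝒞 : Set (PolyFamily k)) : Prop :=
  (∀ f : ∀ n, MvPolynomial (Fin (v n)) k, (∀ n, f n ∈ ℱ n) → (⟨v, f⟩ : PolyFamily k) ∈ 𝒞) ∧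
    ∀ F ∈ 𝒞, ∃ e m : ℕ → ℕ, IsPBounded e ∧ IsPBounded m ∧
      ∀ n, ∃ ι : Fin (F.nvars n) → Fin (v (m n)), Function.Injective ι ∧
        ∃ ℓ : MvPolynomial (Fin (v (m n))) k, ℓ.IsHomogeneous 1 ∧ ℓ ≠ 0 ∧
          ℓ ^ (e n) * rename ι (F.poly n) ∈ ℱ (m n)

/-- Capturing implies capturing with padding when every ambient level has at least one variable
(take `e = 0` and `ℓ_n = x_0`). [cite: GrochowKumarSaksSaraf2017, Def. 1, p.5] locator: paper:arxiv-1701.01717 p0005.txt:L26 -/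
theorem capturesWithPadding_of_captures [Nontrivial k] {v : ℕ → ℕ} (hv : ∀ n, 0 < v n)
    {ℱ : ∀ n, Set (MvPolynomial (Fin (v n)) k)} {𝒞 : Set (PolyFamily k)}
    (h : Captures k v ℱ 𝒞) : CapturesWithPadding k v ℱ 𝒞 := by
  refine ⟨h.1, fun F hF => ?_⟩
  obtain ⟨m, hm, hmem⟩ := h.2 F hF
  refine ⟨fun _ => 0, m, IsPBounded.const 0, hm, fun n => ?_⟩
  obtain ⟨ι, hι, hι'⟩ := hmem n
  refine ⟨ι, hι, X ⟨0, hv (m n)⟩, isHomogeneous_X k _, X_ne_zero _, ?_⟩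
  simpa using hι'

end Captures

/-! ### §2: the printed level families `𝒟_n`, `𝒟ʰ_n`, `𝒮𝒫𝒮_n` and the class `VP_ws` -/

section LevelFamilies

variable (k : Type*) [CommRing k]

/-- **`𝒟_n`** `= {f ∈ Poly^{≤ n}(n²) : ∃ L affine, f = det_n(L(x))}`: polynomials of degree `≤ n`
in `n²` variables that are determinants of `n × n` matrices of affine linear forms (the tree's
`HasDetRepr f n`). "It is readily seen that the family `𝒟_n` captures `VP_ws`": `captures_detSet_VPws` below.
[cite: GrochowKumarSaksSaraf2017, §2 display (𝒟_n), p.4–5] locator: paper:arxiv-1701.01717 p0005.txt:L13 -/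
def detSet (n : ℕ) : Set (MvPolynomial (Fin (n ^ 2)) k) :=
  {f | f.totalDegree ≤ n ∧ HasDetRepr f n}

/-- **`𝒟ʰ_n`** `= {f ∈ Poly^{n}(n²) : ∃ L linear, f = det_n(L(x))}`: the homogeneous version
(degree exactly `n`, entries linear forms with zero constant term), which "captures homogeneous
polynomials in `VP_ws` with padding" (not proved here).
[cite: GrochowKumarSaksSaraf2017, §2 display (𝒟ʰ_n), p.5] locator: paper:arxiv-1701.01717 p0005.txt:L32 -/
def detSetHom (n : ℕ) : Set (MvPolynomial (Fin (n ^ 2)) k) :=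
  {f | f.IsHomogeneous n ∧ ∃ A : Matrix (Fin n) (Fin n) (MvPolynomial (Fin (n ^ 2)) k),
    (∀ i j, (A i j).IsHomogeneous 1) ∧ A.det = f}

/-- **`𝒮𝒫𝒮_n`** `= {f ∈ Poly^{≤ n}(n) : ∃ a_{ijk} ∈ 𝔽, f = Σ_{i=1}^{n} Π_{j=1}^{d(i)} Σ_{k=1}^{n}
a_{ijk} x_k}` (as printed: `n` summands, inner forms without constant term, the fan-ins `d(i)`
unconstrained), which "captures `ΣΠΣ`" (not proved here).
[cite: GrochowKumarSaksSaraf2017, §2 display (𝒮𝒫𝒮_n), p.5] locator: paper:arxiv-1701.01717 p0005.txt:L40 -/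
def spsSet (n : ℕ) : Set (MvPolynomial (Fin n) k) :=
  {f | f.totalDegree ≤ n ∧ ∃ (d : Fin n → ℕ) (a : (i : Fin n) → Fin (d i) → Fin n → k),
    f = ∑ i, ∏ j, ∑ l, C (a i j l) * X l}

/-- **`VP_ws` as defined in GKSS §2**: "the collection of p-families `f = (f_n)` such that
`f_n(x) = det_{poly(n)}(L_n(x))` where `L_n(x)` is a matrix whose entries are affine linear
functions of the `x_i`" — p-families of p-bounded determinantal complexity (tree: `IsPFamily`,
`HasDetRepr`, `IsPBounded`). [cite: GrochowKumarSaksSaraf2017, §2 (VP_ws), p.4] locator: paper:arxiv-1701.01717 p0005.txt:L5 -/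
def VPws : Set (PolyFamily k) :=
  {F | IsPFamily F.poly ∧ ∃ t : ℕ → ℕ, IsPBounded t ∧ ∀ n, HasDetRepr (F.poly n) (t n)}

/-- Condition (1) of "**`𝒟_n` captures `VP_ws`**": a family with `f_n ∈ 𝒟_n` for all `n` is in
`VP_ws` (`n²` variables and degree `≤ n` are p-bounded; `t = id`).
[cite: GrochowKumarSaksSaraf2017, §2, p.5] locator: paper:arxiv-1701.01717 p0005.txt:L30 -/
theorem mem_VPws_of_forall_mem_detSet (f : ∀ n, MvPolynomial (Fin (n ^ 2)) k)
    (hf : ∀ n, f n ∈ detSet k n) : (⟨fun n => n ^ 2, f⟩ : PolyFamily k) ∈ VPws k := by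
  refine ⟨⟨⟨2, fun n => ?_⟩, ⟨1, fun n => ?_⟩⟩, _root_.id, IsPBounded.id, fun n => (hf n).2⟩
  · simp
  · simpa using (hf n).1.trans (Nat.le_succ n)

/-- **"It is readily seen that the family `𝒟_n` above captures `VP_ws`"** — PROVED for the typed
notions. Condition (1) is `mem_VPws_of_forall_mem_detSet`; for (2), a `VP_ws` family with
`nvars_n` variables and affine determinantal representations of p-bounded size `t n` re-indexes
into `𝒟_{m n}`, `m n = nvars_n + t n + 1`: rename the variables into the `(m n)²` ambient ones
(a Valiant projection, `HasDetRepr.of_isProjection_holds`), pad the matrix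
(`HasDetRepr.mono_holds`), and bound the degree by the size (`totalDegree_le_of_hasDetRepr_holds`).
[cite: GrochowKumarSaksSaraf2017, §2 (after Def. 1), p.5] locator: paper:arxiv-1701.01717 p0005.txt:L30 -/
theorem captures_detSet_VPws : Captures k (fun n => n ^ 2) (detSet k) (VPws k) := by
  refine ⟨mem_VPws_of_forall_mem_detSet k, fun F hF => ?_⟩
  obtain ⟨⟨hvars, -⟩, t, ht, hdet⟩ := hF
  have hvars' : IsPBounded F.nvars := by simpa using hvars
  have hm : IsPBounded fun n => F.nvars n + t n + 1 :=
    IsPBounded.add_holds (IsPBounded.add_holds hvars' ht) (IsPBounded.const 1)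
  refine ⟨fun n => F.nvars n + t n + 1, hm, fun n => ?_⟩
  have h1 : F.nvars n ≤ (F.nvars n + t n + 1) ^ 2 :=
    (Nat.le_self_pow two_ne_zero _).trans' (by omega)
  have hproj : IsProjection (rename (Fin.castLE h1) (F.poly n)) (F.poly n) :=
    ⟨fun i => X (Fin.castLE h1 i), fun i => Or.inl ⟨_, rfl⟩, by rw [rename_eq_aeval]; rfl⟩
  have htm : t n ≤ F.nvars n + t n + 1 := (Nat.le_add_left (t n) (F.nvars n)).trans (Nat.le_succ _)
  refine ⟨Fin.castLE h1, Fin.castLE_injective h1, And.intro ?_ ?_⟩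
  · exact (totalDegree_rename_le _ _).trans
      ((totalDegree_le_of_hasDetRepr_holds (hdet n)).trans htm)
  · exact HasDetRepr.mono_holds (HasDetRepr.of_isProjection_holds (hdet n) hproj) htm

end LevelFamilies

/-! ### §2.1 Meta-polynomials: the count `N`, stretched classes (Def. 2, Def. 2′) -/

section Meta

/-- The monomials of degree exactly `d` in `v` variables — a basis of the paper's space
`Poly^{d}(v)` of homogeneous degree-`d` forms; meta-polynomials on `Poly^{d}(v)` are polynomials
in the `N = |homMonomials v d|` coefficient variables (the tree's
`MvPolynomial (homMonomials v d) k`, evaluated at `coeffVector`). [cite: GrochowKumarSaksSaraf2017, §2.1, p.5–6] locator: paper:arxiv-1701.01717 p0006.txt:L1 -/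
def homMonomials (v d : ℕ) : Set (Fin v →₀ ℕ) :=
  {m | m.degree = d}

/-- **`N = binom(d + v - 1, d)`**: the number of meta-variables, i.e. of degree-`d` monomials in
`v` variables ("`T` is a polynomial in `N = binom(d_n + v_n - 1, d_n)` variables"). Proved via
`Sym (Fin v) d`. [cite: GrochowKumarSaksSaraf2017, §2.1, p.5–6] locator: paper:arxiv-1701.01717 p0006.txt:L1 -/
theorem ncard_homMonomials (v d : ℕ) : Nat.card (homMonomials v d) = (d + v - 1).choose d := by
  classical
  have e : homMonomials v d ≃ Sym (Fin v) d :=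
    (Equiv.subtypeEquivRight (fun m => by
      simp [homMonomials, Finsupp.degree_apply, Finsupp.sum])).trans
      (Sym.equivNatSum (Fin v) d).symm
  rw [Nat.card_congr e, Nat.card_eq_fintype_card, Sym.card_sym_eq_choose, Fintype.card_fin,
    Nat.add_comm]

variable (k : Type*) [CommSemiring k]

/-- Re-indexing a family along `N : ℕ → ℕ`: `(T.reindex N)_n = T_{N n}` (the operation behind
Def. 2). Declared as a dot-notation extension of the tree's `PolyFamily`.
[cite: GrochowKumarSaksSaraf2017, Def. 2, p.6] locator: paper:arxiv-1701.01717 p0006.txt:L10 -/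
def _root_.Literature.Computability.AlgebraicComplexity.PolyFamily.reindex {k : Type*}
    [CommSemiring k] (T : PolyFamily k) (N : ℕ → ℕ) : PolyFamily k :=
  ⟨fun n => T.nvars (N n), fun n => T.poly (N n)⟩

/-- **GKSS Def. 2 (stretched complexity classes).** `𝒞` with stretch `N`, `𝒞(N)`: the families
`T = (T_n)` such that `T_n = T̄_{N(n)}` for some `T̄ ∈ 𝒞`.
[cite: GrochowKumarSaksSaraf2017, Def. 2, p.6] locator: paper:arxiv-1701.01717 p0006.txt:L10 -/
def stretch (𝒞 : Set (PolyFamily k)) (N : ℕ → ℕ) : Set (PolyFamily k) :=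
  {T | ∃ Tbar ∈ 𝒞, T = Tbar.reindex N}

/-- "Polynomial in `N(n)`": `t n ≤ N(n)^c + c` for a constant `c` (the tree's `IsPBounded` with
`n` replaced by `N n`, Def. 2′'s "polynomial in `n` everywhere replaced by polynomial in `N(n)`").
[cite: GrochowKumarSaksSaraf2017, Def. 2′, p.6] locator: paper:arxiv-1701.01717 p0006.txt:L15 -/
def IsPBoundedIn (N t : ℕ → ℕ) : Prop :=
  ∃ c : ℕ, ∀ n, t n ≤ N n ^ c + c

/-- **GKSS Def. 2′ for `VP`**: "`VP(N)` denotes the class of families `T = (T_n)` where `T_n` has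
`poly(N)` many variables, is of `poly(N)` degree, and can be computed by circuits of `poly(N)`
size" (size = the tree's fan-in-two `complexity`). [cite: GrochowKumarSaksSaraf2017, Def. 2′ and the example VP(N), p.6] locator: paper:arxiv-1701.01717 p0006.txt:L20 -/
def VPStretch (N : ℕ → ℕ) : Set (PolyFamily k) :=
  {T | IsPBoundedIn N T.nvars ∧ IsPBoundedIn N (fun n => (T.poly n).totalDegree) ∧
    IsPBoundedIn N fun n => complexity (T.poly n)}

/-- A p-bounded function composed with `N` is polynomial in `N` (the content of "Def. 2 ⟹
Def. 2′"). [cite: GrochowKumarSaksSaraf2017, Def. 2′, p.6] locator: paper:arxiv-1701.01717 p0006.txt:L18 -/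
theorem IsPBoundedIn.of_isPBounded_comp {t : ℕ → ℕ} (ht : IsPBounded t) (N : ℕ → ℕ) :
    IsPBoundedIn N (fun n => t (N n)) :=
  let ⟨c, hc⟩ := ht; ⟨c, fun n => hc (N n)⟩

/-- **Def. 2 ⟹ Def. 2′ for `VP`** ("the opposite direction is clear"): a re-indexed `VP` family
has `poly(N)` variables, degree and size. The printed converse (Def. 2′ ⟹ Def. 2, via "the
inverse of `N(n)`") is `VPStretch_subset_stretch_VP` below (for injective `N`).
[cite: GrochowKumarSaksSaraf2017, after Def. 2′, p.6] locator: paper:arxiv-1701.01717 p0006.txt:L18 -/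
theorem stretch_VP_subset_VPStretch (N : ℕ → ℕ) : stretch k (VP k) N ⊆ VPStretch k N := by
  rintro T ⟨Tbar, ⟨⟨hv, hd⟩, hc⟩, rfl⟩
  refine ⟨?_, IsPBoundedIn.of_isPBounded_comp hd N, IsPBoundedIn.of_isPBounded_comp hc N⟩
  obtain ⟨c, hc⟩ := hv
  exact ⟨c, fun n => by simpa [PolyFamily.reindex] using hc (N n)⟩

/-- **Def. 2′ ⟹ Def. 2 for `VP`** (the printed "To see that the two are equivalent: … let
`n̄(N)` be the inverse of `N(n)` …", made precise): for an INJECTIVE stretch function `N`, a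
family with `poly(N)` variables, degree and size is the re-indexing along `N` of a `VP` family —
put `T_n` at level `N n` and the zero polynomial in no variables at the levels outside the range
of `N`. Injectivity is exactly what is needed (if `N n₁ = N n₂` and `T_{n₁} ≠ T_{n₂}` no `T̄`
exists); no monotonicity or growth of `N` is used.
[cite: GrochowKumarSaksSaraf2017, after Def. 2′, p.6] locator: paper:arxiv-1701.01717 p0006.txt:L18 -/
theorem VPStretch_subset_stretch_VP {N : ℕ → ℕ} (hN : Function.Injective N) :
    VPStretch k N ⊆ stretch k (VP k) N := by
  classical
  rintro ⟨nv, po⟩ ⟨⟨c₁, h₁⟩, ⟨c₂, h₂⟩, ⟨c₃, h₃⟩⟩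
  -- the levels of `T̄`: `T_n` at level `N n`, the zero polynomial in no variables elsewhere
  let S : ℕ → (Σ v : ℕ, MvPolynomial (Fin v) k) := fun m =>
    if h : ∃ n, N n = m then ⟨nv h.choose, po h.choose⟩ else ⟨0, 0⟩
  have hS : ∀ n, S (N n) = ⟨nv n, po n⟩ := by
    intro n
    have h : ∃ n', N n' = N n := ⟨n, rfl⟩
    have hn : h.choose = n := hN h.choose_spec
    simp only [S, dif_pos h]
    rw [hn]
  have hSm : ∀ m, (∃ n, N n = m ∧ S m = ⟨nv n, po n⟩) ∨ S m = ⟨0, 0⟩ := by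
    intro m
    by_cases h : ∃ n, N n = m
    · obtain ⟨n, rfl⟩ := h
      exact Or.inl ⟨n, rfl, hS n⟩
    · exact Or.inr (by simp only [S, dif_neg h])
  have h0 : complexity (0 : MvPolynomial (Fin 0) k) = 0 := by
    rw [← C_0]; exact complexity_C_holds 0
  dsimp only at h₁ h₂ h₃
  refine ⟨⟨fun m => (S m).1, fun m => (S m).2⟩, ⟨⟨⟨c₁, fun m => ?_⟩, ⟨c₂, fun m => ?_⟩⟩,
    ⟨c₃, fun m => ?_⟩⟩, ?_⟩
  · rcases hSm m with ⟨n, rfl, he⟩ | he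
    · dsimp only; simp only [Fintype.card_fin]; rw [he]; exact h₁ n
    · dsimp only; simp only [Fintype.card_fin]; rw [he]; exact Nat.zero_le _
  · rcases hSm m with ⟨n, rfl, he⟩ | he
    · dsimp only; rw [he]; exact h₂ n
    · dsimp only; rw [he]; simp
  · rcases hSm m with ⟨n, rfl, he⟩ | he
    · dsimp only; rw [he]; exact h₃ n
    · dsimp only; rw [he]; simp [h0]
  · have e := congrArg (fun F : ℕ → (Σ v : ℕ, MvPolynomial (Fin v) k) =>
      (PolyFamily.mk (fun n => (F n).1) (fun n => (F n).2) : PolyFamily k)) (funext hS)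
    exact e.symm

/-- **Def. 2 ⟺ Def. 2′ for `VP`**, for an injective stretch function.
[cite: GrochowKumarSaksSaraf2017, after Def. 2′, p.6] locator: paper:arxiv-1701.01717 p0006.txt:L18 -/
theorem stretch_VP_eq_VPStretch {N : ℕ → ℕ} (hN : Function.Injective N) :
    stretch k (VP k) N = VPStretch k N :=
  Set.Subset.antisymm (stretch_VP_subset_VPStretch k N) (VPStretch_subset_stretch_VP k hN)

/-- **`VP(N)` at the meta level** (Def. 2′ with `N_n = |M n|`, the number of coefficient
variables): families of meta-polynomials `T_n ∈ k[{c_m}_{m ∈ M n}]` of degree and circuit size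
`≤ N_n^c + c` (the number of variables IS `N_n`). This is the constructivity class of Def. 3
("`T ∈ VP(N)` for `N_n = dim Poly^{d_n}(v_n)`"). `Nat.card` is `0` on an infinite `M n` (junk; the
intended monomial sets are finite). [cite: GrochowKumarSaksSaraf2017, Def. 2′ and Def. 3, p.6] locator: paper:arxiv-1701.01717 p0007.txt:L10 -/
def VPMeta (v : ℕ → ℕ) (M : ∀ n, Set (Fin (v n) →₀ ℕ)) : Set (∀ n, MvPolynomial (M n) k) :=
  {T | ∃ c : ℕ, ∀ n, (T n).totalDegree ≤ Nat.card (M n) ^ c + c ∧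
    complexity (T n) ≤ Nat.card (M n) ^ c + c}

/-- **`VP_ws(N)` at the meta level** ("defined just like `VP_ws`, but where everything — degree,
circuit size, etc. — is measured as a function of the number of variables `N`", §1.1): families of
meta-polynomials of `poly(N)` degree that are determinants of affine matrices of `poly(N)` size.
[cite: GrochowKumarSaksSaraf2017, §1.1 (p.3) and Def. 2′ (p.6)] locator: paper:arxiv-1701.01717 p0004.txt:L1 -/
def VPwsMeta (k : Type*) [CommRing k] (v : ℕ → ℕ) (M : ∀ n, Set (Fin (v n) →₀ ℕ)) :
    Set (∀ n, MvPolynomial (M n) k) :=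
  {T | IsPBoundedIn (fun n => Nat.card (M n)) (fun n => (T n).totalDegree) ∧
    ∃ t : ℕ → ℕ, IsPBoundedIn (fun n => Nat.card (M n)) t ∧ ∀ n, HasDetRepr (T n) (t n)}

end Meta

/-! ### §3 Natural properties (Def. 3, Def. 4), succinct hitting sets (Def. 5), Theorem 1 -/

section NaturalProofs

variable (k : Type*) [CommSemiring k]

/-- **GKSS Def. 3 (natural property)** — the case `Γ = Λ = VP` of Def. 4 with usefulness spelled
out as superpolynomial circuit size. A property `C = (C_n)` of polynomials in the ambient
`k[x_1..x_{v n}]` with coefficient (meta-)variables indexed by `M n` is *natural* if it contains a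
core `C_n^* = {f : T_n(coeff f) ≠ 0} ⊆ C_n` with: *largeness* — `T_n` a nonzero meta-polynomial
(convention 3); *constructivity* — `T = (T_n) ∈ VP(N)`, `N_n = |M n|` (`VPMeta`); *usefulness* —
every family `(f_n)` with `f_n ∈ C_n` for all `n` has, for every `d`, circuit size `> n^d` for all
sufficiently large `n`. Remark 1 (p0007:L14): constructivity is about computing `T` SYMBOLICALLY,
not about deciding membership in `C_n^*`; Remark 2 (p0007:L19): the intended fields are infinite
(or of size `> 2·degree`). [cite: GrochowKumarSaksSaraf2017, Def. 3, p.6] locator: paper:arxiv-1701.01717 p0007.txt:L5 -/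
def IsNaturalProperty {v : ℕ → ℕ} (M : ∀ n, Set (Fin (v n) →₀ ℕ))
    (C : ∀ n, Set (MvPolynomial (Fin (v n)) k)) : Prop :=
  ∃ T : ∀ n, MvPolynomial (M n) k,
    (∀ n, T n ≠ 0) ∧
    (∀ n (f : MvPolynomial (Fin (v n)) k), eval (coeffVector (M n) f) (T n) ≠ 0 → f ∈ C n) ∧
    T ∈ VPMeta k v M ∧
    ∀ f : ∀ n, MvPolynomial (Fin (v n)) k, (∀ n, f n ∈ C n) →
      ∀ d : ℕ, ∃ n₀, ∀ n, n₀ ≤ n → n ^ d < complexity (f n)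

/-- **GKSS Def. 4 (`Γ`-natural against `Λ`)**, for a presentation (convention 1): `Γ` a set of
meta-polynomial families (the stretched class `Γ(N)`, e.g. `VPMeta k v M`), `Λ` the level sets of
the simple class. `C` is `Γ`-natural against `Λ` if it contains a core `{f : T_n(coeff f) ≠ 0} ⊆
C_n` with *largeness* (`T_n ≠ 0`), *`Γ`-constructivity* (`T ∈ Γ`) and *usefulness against `Λ`*:
every family `(f_n)` with `f_n ∈ C_n` for all `n` "is not contained in `Λ`", i.e. (convention 2)
`f_n ∉ Λ(n)` for infinitely many `n`. [cite: GrochowKumarSaksSaraf2017, Def. 4, p.7] locator: paper:arxiv-1701.01717 p0007.txt:L24 -/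
def IsNaturalAgainst {v : ℕ → ℕ} (M : ∀ n, Set (Fin (v n) →₀ ℕ))
    (Γ : Set (∀ n, MvPolynomial (M n) k)) (Λ C : ∀ n, Set (MvPolynomial (Fin (v n)) k)) : Prop :=
  ∃ T ∈ Γ, (∀ n, T n ≠ 0) ∧
    (∀ n (f : MvPolynomial (Fin (v n)) k), eval (coeffVector (M n) f) (T n) ≠ 0 → f ∈ C n) ∧
    ∀ f : ∀ n, MvPolynomial (Fin (v n)) k, (∀ n, f n ∈ C n) → ∀ n₀, ∃ n, n₀ ≤ n ∧ f n ∉ Λ n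

/-- **GKSS Def. 5 (succinct hitting set), for a fixed presentation `Λ(n)`:** "`{coeff f : f ∈
Λ(n)}` is a hitting set against `Γ(N)`. Namely, for all nonzero `T ∈ Γ(N)`, there is some
`f ∈ Λ(n)` such that `T(coeff f) ≠ 0`" — every nowhere-zero family `T ∈ Γ` is hit by `Λ(n)` at
all sufficiently large `n` (conventions 2–3). At a single level this is the tree's
`IsSuccinctHittingSet (M n) (Λ n) 𝒟` for a level class `𝒟` (FSV Def. 3); GKSS quantify over
FAMILIES `T`. [cite: GrochowKumarSaksSaraf2017, Def. 5, p.8] locator: paper:arxiv-1701.01717 p0007.txt:L39 -/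
def IsSuccinctHittingSetFor {v : ℕ → ℕ} (M : ∀ n, Set (Fin (v n) →₀ ℕ))
    (Λ : ∀ n, Set (MvPolynomial (Fin (v n)) k)) (Γ : Set (∀ n, MvPolynomial (M n) k)) : Prop :=
  ∀ T ∈ Γ, (∀ n, T n ≠ 0) →
    ∃ n₀, ∀ n, n₀ ≤ n → ∃ f ∈ Λ n, eval (coeffVector (M n) f) (T n) ≠ 0

/-- A stretched meta-class FORMER: to an ambient (`v n` variables, coefficient index sets `M n`,
`N_n = |M n|`) it assigns the set of meta-polynomial families `Γ(N)` — e.g. `VPMeta k`,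
`VPwsMeta k`. (An `abbrev` for readability; no notation.) [cite: GrochowKumarSaksSaraf2017, Def. 2 (p.6) and Def. 5 (p.8)] -/
abbrev MetaClassFormer (k : Type*) [CommSemiring k] :=
  ∀ (v : ℕ → ℕ) (M : ∀ n, Set (Fin (v n) →₀ ℕ)), Set (∀ n, MvPolynomial (M n) k)

/-- **GKSS Def. 5 (class level, as printed):** "An algebraic complexity class `Λ` is a succinct
hitting set against another class `Γ` if there is a family of sets `Λ(n)` which captures `Λ`, such
that `{coeff f : f ∈ Λ(n)}` is a hitting set against `Γ(N)`, where `N` is the dimension of the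
ambient space of `Λ(n)`." The ambient of the presentation is part of the data: `v n` variables and
a FINITE monomial set `M n` supporting every member of `Λ(n)` (so that `N_n = |M n|` is honestly
the ambient dimension), and `Γ(N)` is the former `Γ` evaluated there.
[cite: GrochowKumarSaksSaraf2017, Def. 5, p.8] locator: paper:arxiv-1701.01717 p0007.txt:L39 -/
def IsSuccinctHittingSetAgainst (Λ : Set (PolyFamily k)) (Γ : MetaClassFormer k) : Prop :=
  ∃ (v : ℕ → ℕ) (M : ∀ n, Set (Fin (v n) →₀ ℕ)) (Λl : ∀ n, Set (MvPolynomial (Fin (v n)) k)),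
    (∀ n, (M n).Finite) ∧ (∀ n, ∀ f ∈ Λl n, ∀ m ∈ f.support, m ∈ M n) ∧
      Captures k v Λl Λ ∧ IsSuccinctHittingSetFor k M Λl (Γ v M)

variable {k}

/-- **Thm. 1, the direction needing no hypothesis on the field**: if `Λ(n)` is NOT a succinct
hitting set against `Γ`, then some property is `Γ`-natural against `Λ` — namely the core itself,
`C_n := {f : T_n(coeff f) ≠ 0}` for the witness `T` ("We have essentially already given the
proof in the paragraph above"). [cite: GrochowKumarSaksSaraf2017, Thm. 1, p.8] locator: paper:arxiv-1701.01717 p0007.txt:L42 -/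
theorem exists_isNaturalAgainst_of_not_isSuccinctHittingSetFor {v : ℕ → ℕ}
    {M : ∀ n, Set (Fin (v n) →₀ ℕ)} {Λ : ∀ n, Set (MvPolynomial (Fin (v n)) k)}
    {Γ : Set (∀ n, MvPolynomial (M n) k)} (h : ¬ IsSuccinctHittingSetFor k M Λ Γ) :
    ∃ C, IsNaturalAgainst k M Γ Λ C := by
  simp only [IsSuccinctHittingSetFor, not_forall, not_exists, exists_prop, not_and] at h
  obtain ⟨T, hT, hT0, hvan⟩ := h
  refine ⟨fun n => {f | eval (coeffVector (M n) f) (T n) ≠ 0}, T, hT, hT0,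
    fun n f hf => hf, fun f hf n₀ => ?_⟩
  obtain ⟨n, hn, hno⟩ := hvan n₀
  refine ⟨n, hn, fun hmem => ?_⟩
  exact hno (f n) hmem (hf n)

/-- Over an infinite integral domain a nonzero meta-polynomial is nonzero at the coefficient vector
of SOME polynomial (take a non-root on the finitely many coefficient variables that occur and the
polynomial with exactly those coefficients). [folklore] -/
private theorem exists_eval_coeffVector_ne_zero {k : Type*} [CommRing k] [IsDomain k] [Infinite k]
    {σ : Type*} (M : Set (σ →₀ ℕ)) {T : MvPolynomial M k} (hT : T ≠ 0) :
    ∃ f : MvPolynomial σ k, eval (coeffVector M f) T ≠ 0 := by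
  classical
  obtain ⟨s, q, rfl⟩ := exists_finset_rename T
  have hq : q ≠ 0 := by rintro rfl; simp at hT
  by_contra hcon
  push Not at hcon
  apply hq
  apply MvPolynomial.funext
  intro c₀
  rw [map_zero]
  let f : MvPolynomial σ k := ∑ m ∈ s.attach, monomial ((m : M) : σ →₀ ℕ) (c₀ m)
  have hf : ∀ m : s, coeffVector M f m = c₀ m := by
    intro m
    simp only [coeffVector_apply, f, coeff_sum, coeff_monomial]
    rw [Finset.sum_eq_single m]
    · simp
    · intro b _ hb
      rw [if_neg]
      intro hbm
      exact hb (Subtype.ext (Subtype.ext hbm))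
    · intro hm
      exact absurd (Finset.mem_attach _ _) hm
  have h0 := hcon f
  rw [eval_rename] at h0
  have : (coeffVector M f ∘ Subtype.val : s → k) = c₀ := funext fun m => hf m
  rwa [this] at h0

/-- **Thm. 1, the direction using the field**: if `Λ(n)` IS a succinct hitting set against `Γ`
then no property is `Γ`-natural against `Λ`: hit the core at all large `n` by members of `Λ(n)`,
fill the finitely many small levels with arbitrary members of the (nonempty, by largeness over an
infinite domain) core, and contradict usefulness. [cite: GrochowKumarSaksSaraf2017, Thm. 1, p.8] locator: paper:arxiv-1701.01717 p0007.txt:L42 -/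
theorem not_exists_isNaturalAgainst_of_isSuccinctHittingSetFor {k : Type*} [CommRing k]
    [IsDomain k] [Infinite k] {v : ℕ → ℕ} {M : ∀ n, Set (Fin (v n) →₀ ℕ)}
    {Λ : ∀ n, Set (MvPolynomial (Fin (v n)) k)} {Γ : Set (∀ n, MvPolynomial (M n) k)}
    (h : IsSuccinctHittingSetFor k M Λ Γ) : ¬ ∃ C, IsNaturalAgainst k M Γ Λ C := by
  classical
  rintro ⟨C, T, hT, hT0, hlarge, huse⟩
  obtain ⟨n₀, hn₀⟩ := h T hT hT0
  choose g hgΛ hgT using fun n (hn : n₀ ≤ n) => hn₀ n hn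
  choose g' hg'T using fun n => exists_eval_coeffVector_ne_zero (M n) (hT0 n)
  let f : ∀ n, MvPolynomial (Fin (v n)) k := fun n => if hn : n₀ ≤ n then g n hn else g' n
  have hfC : ∀ n, f n ∈ C n := by
    intro n
    by_cases hn : n₀ ≤ n
    · simp only [f, dif_pos hn]; exact hlarge n _ (hgT n hn)
    · simp only [f, dif_neg hn]; exact hlarge n _ (hg'T n)
  obtain ⟨n, hn, hnot⟩ := huse f hfC n₀
  simp only [f, dif_pos hn] at hnot
  exact hnot (hgΛ n hn)

/-- **GKSS Theorem 1 (load-bearing).** "For any two algebraic complexity classes `Γ, Λ`, there is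
a `Λ`-succinct hitting set against `Γ` if and only if there is no property which is `Γ`-natural
against `Λ`" — for a presentation `Λ(n)` and a set `Γ` of meta-polynomial families, with the
reading conventions of the module docstring; over any infinite integral domain (Remark 2: "it may
be easier to think of `𝔽` as any infinite field"). The class-level statement with `Λ` ranging over
capturing families (`IsSuccinctHittingSetAgainst`) is this equivalence applied to the chosen
presentation. The single-level content is FSV Thm. 4, the tree's `exists_isNaturalProof_iff`.
[cite: GrochowKumarSaksSaraf2017, Thm. 1, p.8] locator: paper:arxiv-1701.01717 p0007.txt:L42 -/
theorem isSuccinctHittingSetFor_iff_not_exists_isNaturalAgainst {k : Type*} [CommRing k]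
    [IsDomain k] [Infinite k] {v : ℕ → ℕ} (M : ∀ n, Set (Fin (v n) →₀ ℕ))
    (Λ : ∀ n, Set (MvPolynomial (Fin (v n)) k)) (Γ : Set (∀ n, MvPolynomial (M n) k)) :
    IsSuccinctHittingSetFor k M Λ Γ ↔ ¬ ∃ C, IsNaturalAgainst k M Γ Λ C :=
  ⟨not_exists_isNaturalAgainst_of_isSuccinctHittingSetFor,
    fun h => by_contra fun hS => h (exists_isNaturalAgainst_of_not_isSuccinctHittingSetFor hS)⟩

/-- **GKSS Theorem 1**, short alias of `isSuccinctHittingSetFor_iff_not_exists_isNaturalAgainst`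
(the cell's load-bearing name `GKSS2017.thm1`). [cite: GrochowKumarSaksSaraf2017, Thm. 1, p.8] locator: paper:arxiv-1701.01717 p0007.txt:L42 -/
theorem thm1 {k : Type*} [CommRing k] [IsDomain k] [Infinite k] {v : ℕ → ℕ}
    (M : ∀ n, Set (Fin (v n) →₀ ℕ)) (Λ : ∀ n, Set (MvPolynomial (Fin (v n)) k))
    (Γ : Set (∀ n, MvPolynomial (M n) k)) :
    IsSuccinctHittingSetFor k M Λ Γ ↔ ¬ ∃ C, IsNaturalAgainst k M Γ Λ C :=
  isSuccinctHittingSetFor_iff_not_exists_isNaturalAgainst M Λ Γ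

/-- The paper's "key observation" (§3, p0007:L35) in the typed frame: if `Λ(n)` is a succinct
hitting set against `Γ`, then no nowhere-zero `T ∈ Γ` vanishes on `Λ(n)` for infinitely many
`n` — "one cannot prove a lower bound against `Λ` by exhibiting a meta-polynomial [in `Γ`] that
vanishes on a family of sets capturing `Λ`". [cite: GrochowKumarSaksSaraf2017, §3 (key observation), p.7] locator: paper:arxiv-1701.01717 p0007.txt:L35 -/
theorem not_frequently_vanishing_of_isSuccinctHittingSetFor {v : ℕ → ℕ}
    {M : ∀ n, Set (Fin (v n) →₀ ℕ)} {Λ : ∀ n, Set (MvPolynomial (Fin (v n)) k)}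
    {Γ : Set (∀ n, MvPolynomial (M n) k)} (h : IsSuccinctHittingSetFor k M Λ Γ)
    {T : ∀ n, MvPolynomial (M n) k} (hT : T ∈ Γ) (hT0 : ∀ n, T n ≠ 0) :
    ¬ ∀ n₀, ∃ n, n₀ ≤ n ∧ ∀ f ∈ Λ n, eval (coeffVector (M n) f) (T n) = 0 := by
  intro hvan
  obtain ⟨n₀, hn₀⟩ := h T hT hT0
  obtain ⟨n, hn, hall⟩ := hvan n₀
  obtain ⟨f, hf, hne⟩ := hn₀ n hn
  exact hne (hall f hf)

end NaturalProofs

/-! ### §3 Open Question 1 (QUESTIONS as printed — neutral `Prop`s, never asserted) -/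

section Questions

/-- **GKSS Open Question 1, first half (QUESTION, open — not a fact):** "Is `VP` a succinct hitting
set against `VP`?" — is there a presentation `Λ(n)` of `VP k` (Def. 1) whose coefficient vectors
hit every `VP(N)` family of meta-polynomials (Def. 5)? Compare the tree's FSV formalisation
`SuccinctHittingSetsForVP F` (fixed ambient `k[x]^{≤ n}_n`, "∀ distinguisher exponent ∃ size
exponent"): the two typed statements differ in quantifier structure and no implication is claimed.
Intended over an infinite (or large) field (Remark 2). [cite: GrochowKumarSaksSaraf2017, Open Question 1, p.8] locator: paper:arxiv-1701.01717 p0008.txt:L5 -/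
def openQuestion1_VP (k : Type*) [CommSemiring k] : Prop :=
  IsSuccinctHittingSetAgainst k (VP k) (VPMeta k)

/-- **GKSS Open Question 1, second half (QUESTION, open — not a fact):** "Is `VP_ws` a succinct
hitting set against `VP_ws`?" (`VP_ws` as defined in §2 = p-bounded determinantal complexity;
`VP_ws(N)` = `VPwsMeta`). The route BarrierLever's item `SuccinctHittingSetsForVBP` (Summits side)
is the FSV-style neighbour of this question. [cite: GrochowKumarSaksSaraf2017, Open Question 1, p.8] locator: paper:arxiv-1701.01717 p0008.txt:L5 -/
def openQuestion1_VPws (k : Type*) [CommRing k] : Prop :=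
  IsSuccinctHittingSetAgainst k (VPws k) (VPwsMeta k)

/-- **The remark after Open Question 1 (QUESTION, open — not a fact):** "We note that it is not
even obvious whether or not `VNP` is a succinct hitting set against `VP_ws`."
[cite: GrochowKumarSaksSaraf2017, after Open Question 1, p.8] locator: paper:arxiv-1701.01717 p0008.txt:L8 -/
def question_VNP_VPws (k : Type*) [CommRing k] : Prop :=
  IsSuccinctHittingSetAgainst k (VNP k) (VPwsMeta k)

end Questions

/-! ### §4.1 Geometric complexity theory: test `G`-modules and Open Question 2

Remark 3 (generators, p0008:L10): "a generator for a class `Γ` is a vector-valued function `G(x_1,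
…, x_s)` such that for any nonzero `f ∈ Γ`, `f(G(x))` is not identically zero" is the tree's
`IsHittingSetGenerator` (`AlgebraicNaturalProofsGenerators.lean`, KRST Def. 5 / FSV Def. 7); the
remark's example (linear projections of `det_n` as a seed-length-`n⁴` generator for any `Γ(N)` hit
by `VP_ws`) is not typed. -/

section GCT

variable {k : Type*} [CommSemiring k] {G : Type*} [Monoid G]

/-- **Test `G`-module** (GKSS §4.1 after [GrochowGCTUnity]): a linear representation `ρ` of `G`
on a space of meta-polynomials being given (e.g. induced from `GL_v` or `S_v` acting on the
variables), a *test `G`-module* is a `G`-stable linear subspace `V` of meta-polynomials — "its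
vanishing is a test for having a given `G`-invariant property". Only `G`-stability is recorded;
no highest-weight theory is needed for what follows (p0009:L11).
[cite: GrochowKumarSaksSaraf2017, §4.1, p.9] locator: paper:arxiv-1701.01717 p0009.txt:L5 -/
def IsTestModule {M : Type*} (ρ : Representation k G (MvPolynomial M k))
    (V : Submodule k (MvPolynomial M k)) : Prop :=
  ∀ g : G, ∀ T ∈ V, ρ g T ∈ V

/-- **The §4.1 observation** (p0009:L11): if `Γ`-natural proofs cannot prove lower bounds against
`Λ` — i.e. `Λ(n)` is a succinct hitting set against `Γ` (Thm. 1) — and a sequence of test modules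
`V_n` contains a nowhere-zero family `(T_n ∈ V_n)` lying in `Γ`, then `V_n` "is not useful against
`Λ(n)` — that is, `V_n` does not vanish identically on `Λ(n)`" for all sufficiently large `n` (in
particular for infinitely many `n`, as printed). The group action plays no role.
[cite: GrochowKumarSaksSaraf2017, §4.1 (before Open Question 2), p.9] locator: paper:arxiv-1701.01717 p0009.txt:L11 -/
theorem exists_not_vanishing_of_testModule {v : ℕ → ℕ} {M : ∀ n, Set (Fin (v n) →₀ ℕ)}
    {Λ : ∀ n, Set (MvPolynomial (Fin (v n)) k)} {Γ : Set (∀ n, MvPolynomial (M n) k)}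
    (h : IsSuccinctHittingSetFor k M Λ Γ) (V : ∀ n, Submodule k (MvPolynomial (M n) k))
    {T : ∀ n, MvPolynomial (M n) k} (hT : T ∈ Γ) (hTV : ∀ n, T n ∈ V n) (hT0 : ∀ n, T n ≠ 0) :
    ∃ n₀, ∀ n, n₀ ≤ n → ∃ S ∈ V n, ∃ f ∈ Λ n, eval (coeffVector (M n) f) S ≠ 0 := by
  obtain ⟨n₀, hn₀⟩ := h T hT hT0
  exact ⟨n₀, fun n hn => let ⟨f, hf, hne⟩ := hn₀ n hn; ⟨T n, hTV n, f, hf, hne⟩⟩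

/-- **GKSS Open Question 2 — the quantity asked for**: "For any given sequence of test `G`-modules
`V_n`, what is the complexity of the easiest family of meta-polynomials `(T_n ∈ V_n)`?" — at level
`n`, the least circuit size of a nonzero member of `V_n` (junk `0` when `V_n = 0`; the family
version asks for the growth of this in `N_n`). QUESTION, not a fact; nothing is asserted about its
value. [cite: GrochowKumarSaksSaraf2017, Open Question 2, p.9] locator: paper:arxiv-1701.01717 p0009.txt:L13 -/
def easiestComplexity {M : Type*} (V : Submodule k (MvPolynomial M k)) : ℕ :=
  sInf {s | ∃ T ∈ V, T ≠ 0 ∧ complexity T = s}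

/-- **GKSS Open Question 2 — yes/no form for a given `Γ`**: does the sequence of test modules
`V_n` contain a nowhere-zero family of meta-polynomials lying in `Γ` (e.g. `Γ = VPMeta k v M`)?
("which families `V_{λ(n)}` of test `GL_n`-modules contain a family of test polynomials `T_n` such
that `(T_n) ∈ Γ`?", p0009:L21). QUESTION schema, not a fact. [cite: GrochowKumarSaksSaraf2017, Open Question 2 and §4.1, p.9–10] locator: paper:arxiv-1701.01717 p0009.txt:L21 -/
def HasTestFamilyIn {v : ℕ → ℕ} {M : ∀ n, Set (Fin (v n) →₀ ℕ)}
    (V : ∀ n, Submodule k (MvPolynomial (M n) k)) (Γ : Set (∀ n, MvPolynomial (M n) k)) : Prop :=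
  ∃ T ∈ Γ, ∀ n, T n ∈ V n ∧ T n ≠ 0

end GCT

/-! ### §4.2 Algebraic proof complexity: the Geometric Ideal Proof System -/

section GeometricIPS

variable {k : Type*} [CommRing k]

/-- **Definition (Geometric IPS certificate, [GP] as printed in GKSS §4.2).** For a system of
polynomial equations `f_1(x) = ⋯ = f_m(x) = 0` in `n` variables, a geometric IPS certificate of
unsatisfiability is a polynomial `C(y_1, …, y_m)` (computed by an algebraic circuit) with
`C(0) = 1` and `C(f_1(x), …, f_m(x)) = 0`, "in other words, `C` is a polynomial relation amongst
the `f_i`". [cite: GrochowKumarSaksSaraf2017, §4.2 Definition (Geometric IPS), p.10] locator: paper:arxiv-1701.01717 p0010.txt:L3 -/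
def IsGeometricIPSCertificate {m n : ℕ} (f : Fin m → MvPolynomial (Fin n) k)
    (C : MvPolynomial (Fin m) k) : Prop :=
  eval 0 C = 1 ∧ aeval f C = 0

/-- **Geometric `𝒞`-IPS proof** ([GP] via GKSS §4.2): "an algebraic circuit in `𝒞` on inputs
`y_1, …, y_m` computing some geometric IPS certificate" — for a level class `𝒞` of polynomials in
the `m` certificate variables. [cite: GrochowKumarSaksSaraf2017, §4.2 Definition (Geometric IPS), p.10] locator: paper:arxiv-1701.01717 p0010.txt:L10 -/
def HasGeometricIPSProof {m n : ℕ} (𝒞 : Set (MvPolynomial (Fin m) k))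
    (f : Fin m → MvPolynomial (Fin n) k) : Prop :=
  ∃ C ∈ 𝒞, IsGeometricIPSCertificate f C

/-- Evaluating `C(f_1(x), …, f_m(x))` at a point `a` is evaluating `C` at `(f_1(a), …, f_m(a))`.
[folklore] -/
private theorem eval_aeval_eq {m n : ℕ} (f : Fin m → MvPolynomial (Fin n) k)
    (C : MvPolynomial (Fin m) k) (a : Fin n → k) : eval a (aeval f C) = eval (fun i => eval a (f i)) C := by
  rw [aeval_def, eval₂_comp_left]
  simp only [MvPolynomial.eval, eval₂Hom, RingHom.coe_mk, MonoidHom.coe_mk, OneHom.coe_mk]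
  congr 1
  ext r
  simp

/-- **Soundness of geometric IPS** ("geometric IPS … is a sound and complete proof system for such
systems of equations", [GP] via GKSS §4.2; the soundness half): a certificate shows that the `f_i`
have no common zero — at a common zero `a`, `C(f(a)) = C(0) = 1 ≠ 0`. (Completeness, a
Nullstellensatz-type statement of [GP], is not formalised.) [cite: GrochowKumarSaksSaraf2017, §4.2, p.10] locator: paper:arxiv-1701.01717 p0010.txt:L12 -/
theorem not_exists_commonZero_of_certificate [Nontrivial k] {m n : ℕ}
    {f : Fin m → MvPolynomial (Fin n) k} {C : MvPolynomial (Fin m) k}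
    (hC : IsGeometricIPSCertificate f C) : ¬ ∃ a : Fin n → k, ∀ i, eval a (f i) = 0 := by
  rintro ⟨a, ha⟩
  have h := congrArg (eval a) hC.2
  rw [eval_aeval_eq, map_zero] at h
  have h0 : (fun i => eval a (f i)) = 0 := funext ha
  rw [h0, hC.1] at h
  exact one_ne_zero h

/-- The factor of a literal in the clause equation: `1 - x` for the positive literal `x`, `x` for
the negated literal `¬x` — zero at a Boolean point iff the literal is TRUE there.
[cite: GrochowKumarSaksSaraf2017, §4.2 (3CNF translation), p.10] locator: paper:arxiv-1701.01717 p0010.txt:L12 -/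
def literalFactor {n : ℕ} (l : Computability.Complexity.Literal (Fin n)) :
    MvPolynomial (Fin n) k :=
  if l.2 then 1 - X l.1 else X l.1

/-- **The clause equation** ("translate it into a system of `m` polynomials of degree at most `3`
in the natural way, so that any Boolean assignment to the variables satisfies a clause iff the
corresponding polynomial evaluates to `0`"): the product of the literal factors.
[cite: GrochowKumarSaksSaraf2017, §4.2 (3CNF translation), p.10] locator: paper:arxiv-1701.01717 p0010.txt:L12 -/
def clauseEq {n : ℕ} (c : Computability.Complexity.Clause (Fin n)) : MvPolynomial (Fin n) k :=
  (c.map literalFactor).prod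

/-- The Boolean axiom `x_i² - x_i`. [cite: GrochowKumarSaksSaraf2017, §4.2, p.10] locator: paper:arxiv-1701.01717 p0010.txt:L12 -/
def boolAxiom {n : ℕ} (i : Fin n) : MvPolynomial (Fin n) k :=
  X i ^ 2 - X i

/-- **The polynomial system of a CNF** `φ` on `n` variables: the clause equations followed by the
`n` Boolean axioms — the map `f : 𝔽^n → 𝔽^{|φ| + n}` of §4.2 whose IMAGE is the geometric object
of interest. [cite: GrochowKumarSaksSaraf2017, §4.2, p.10] locator: paper:arxiv-1701.01717 p0010.txt:L12 -/
def cnfEquations {n : ℕ} (φ : Computability.Complexity.CNF (Fin n)) :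
    Fin (φ.length + n) → MvPolynomial (Fin n) k :=
  Fin.append (fun j => clauseEq (φ.get j)) boolAxiom

/-- The `0/1` point of an assignment. [folklore] -/
def boolPoint {n : ℕ} (σ : Fin n → Bool) : Fin n → k := fun i => if σ i then 1 else 0

/-- At a Boolean point the literal factor vanishes iff the literal is true. [folklore] -/
private theorem eval_literalFactor_eq_zero_iff [Nontrivial k] {n : ℕ} (σ : Fin n → Bool)
    (l : Computability.Complexity.Literal (Fin n)) :
    eval (boolPoint (k := k) σ) (literalFactor l) = 0 ↔
      Computability.Complexity.Literal.eval σ l = true := by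
  rcases l with ⟨x, b⟩
  cases b <;> cases hx : σ x <;>
    simp [literalFactor, boolPoint, Computability.Complexity.Literal.eval, hx]

/-- **"Any Boolean assignment satisfies a clause iff the corresponding polynomial evaluates to
`0`"** (over an integral domain). [cite: GrochowKumarSaksSaraf2017, §4.2 (3CNF translation), p.10] locator: paper:arxiv-1701.01717 p0010.txt:L12 -/
theorem eval_clauseEq_eq_zero_iff [IsDomain k] {n : ℕ} (σ : Fin n → Bool)
    (c : Computability.Complexity.Clause (Fin n)) :
    eval (boolPoint (k := k) σ) (clauseEq c) = 0 ↔
      Computability.Complexity.Clause.eval σ c = true := by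
  simp only [clauseEq, map_list_prod, List.map_map, List.prod_eq_zero_iff, List.mem_map,
    Function.comp_apply, Computability.Complexity.Clause.eval, List.any_eq_true]
  constructor
  · rintro ⟨l, hl, h0⟩
    exact ⟨l, hl, (eval_literalFactor_eq_zero_iff σ l).1 h0⟩
  · rintro ⟨l, hl, h⟩
    exact ⟨l, hl, (eval_literalFactor_eq_zero_iff σ l).2 h⟩

/-- The clause equations have degree at most the clause width (so `≤ 3` for a 3CNF).
[cite: GrochowKumarSaksSaraf2017, §4.2 ("degree at most 3"), p.10] locator: paper:arxiv-1701.01717 p0010.txt:L12 -/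
theorem totalDegree_clauseEq_le {n : ℕ} (c : Computability.Complexity.Clause (Fin n)) :
    (clauseEq (k := k) c).totalDegree ≤ c.length := by
  induction c with
  | nil => simp [clauseEq]
  | cons l c ih =>
    simp only [clauseEq, List.map_cons, List.prod_cons, List.length_cons] at ih ⊢
    refine (totalDegree_mul _ _).trans ?_
    have hl : (literalFactor (k := k) l).totalDegree ≤ 1 := by
      unfold literalFactor
      split_ifs
      · exact (totalDegree_sub _ _).trans (max_le (by simp) (totalDegree_X_le_one _))
      · exact totalDegree_X_le_one _
    omega

/-- **"The 3CNF is unsatisfiable iff the corresponding equations `f_1 = ⋯ = f_m = x_1² - x_1 =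
⋯ = x_n² - x_n = 0` are unsatisfiable over `𝔽`"** (any integral domain; stated positively:
satisfiable iff the system has a common zero). [cite: GrochowKumarSaksSaraf2017, §4.2, p.10] locator: paper:arxiv-1701.01717 p0010.txt:L12 -/
theorem cnf_satisfiable_iff_exists_commonZero [IsDomain k] {n : ℕ}
    (φ : Computability.Complexity.CNF (Fin n)) :
    Computability.Complexity.CNF.Satisfiable φ ↔
      ∃ a : Fin n → k, ∀ i, eval a (cnfEquations φ i) = 0 := by
  classical
  constructor
  · rintro ⟨σ, hσ⟩
    refine ⟨boolPoint σ, fun i => ?_⟩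
    refine Fin.addCases (fun j => ?_) (fun j => ?_) i
    · rw [cnfEquations, Fin.append_left, eval_clauseEq_eq_zero_iff]
      rw [Computability.Complexity.CNF.eval_eq_true_iff] at hσ
      exact hσ _ (List.get_mem φ j)
    · simp only [cnfEquations, Fin.append_right, boolAxiom, map_sub, map_pow, eval_X, boolPoint]
      split_ifs <;> ring
  · rintro ⟨a, ha⟩
    -- the Boolean axioms force `a i ∈ {0, 1}`
    have hbool : ∀ i : Fin n, a i = 0 ∨ a i = 1 := by
      intro i
      have h := ha (Fin.natAdd φ.length i)
      simp only [cnfEquations, Fin.append_right, boolAxiom, map_sub, map_pow, eval_X] at h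
      have h' : a i * (a i - 1) = 0 := by rw [← h]; ring
      rcases mul_eq_zero.1 h' with h0 | h1
      · exact Or.inl h0
      · exact Or.inr (sub_eq_zero.1 h1)
    let σ : Fin n → Bool := fun i => decide (a i = 1)
    have hpt : boolPoint (k := k) σ = a := by
      funext i
      rcases hbool i with h0 | h1
      · simp [boolPoint, σ, h0]
      · simp [boolPoint, σ, h1]
    refine ⟨σ, ?_⟩
    rw [Computability.Complexity.CNF.eval_eq_true_iff]
    intro c hc
    obtain ⟨j, rfl⟩ := List.get_of_mem hc
    have h := ha (Fin.castAdd n j)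
    rw [cnfEquations, Fin.append_left, ← hpt, eval_clauseEq_eq_zero_iff] at h
    exact h

/-- **The image of a polynomial map as a hitting set** (§4.2, p0010:L16–L22): the image of
`f = (f_1, …, f_m) : 𝔽^n → 𝔽^m` hits the class `𝒟` of polynomials in `y_1, …, y_m` if every
nonzero `C ∈ 𝒟` is nonzero at some point `f(a)` of the image ("here we are using the evaluations
of polynomials rather than their coefficient vectors"). [cite: GrochowKumarSaksSaraf2017, §4.2, p.11] locator: paper:arxiv-1701.01717 p0010.txt:L16 -/
def ImageHits {m n : ℕ} (f : Fin m → MvPolynomial (Fin n) k) (𝒟 : Set (MvPolynomial (Fin m) k)) :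
    Prop :=
  ∀ C ∈ 𝒟, C ≠ 0 → ∃ a : Fin n → k, eval (fun i => eval a (f i)) C ≠ 0

/-- **The §4.2 observation**: if the image of `f` is a hitting set against `Λ`, "then, by condition
(2) of the above definition, no geometric `Λ`-IPS certificate can exist" (a certificate is nonzero
by `C(0) = 1` and vanishes identically on the image). [cite: GrochowKumarSaksSaraf2017, §4.2, p.11] locator: paper:arxiv-1701.01717 p0010.txt:L22 -/
theorem not_hasGeometricIPSProof_of_imageHits [Nontrivial k] {m n : ℕ}
    {f : Fin m → MvPolynomial (Fin n) k} {Λ : Set (MvPolynomial (Fin m) k)}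
    (h : ImageHits f Λ) : ¬ HasGeometricIPSProof Λ f := by
  rintro ⟨C, hC, h1, h2⟩
  have hC0 : C ≠ 0 := by rintro rfl; simp at h1
  obtain ⟨a, ha⟩ := h C hC hC0
  apply ha
  rw [← eval_aeval_eq, h2, map_zero]

/-- **GKSS Open Question 3 (QUESTION schema — not a fact)**, for a class `Λ` presented by level
sets indexed by the number of certificate variables: "prove lower bounds on the Geometric
`Λ`-Ideal Proof System by finding a succinct hitting set of the following form: there is a family of
unsatisfiable 3CNFs `(φ_n)` such that, if `f_n` is the above polynomial map associated to `φ_n`,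
then the image of `f_n` is a hitting set against `Λ`" (which, by
`not_hasGeometricIPSProof_of_imageHits`, rules out geometric `Λ`-IPS refutations of the `φ_n`).
"Of course, it would also be interesting to show that for certain `Λ` no hitting sets of this form
exist." As printed the family `(φ_n)` is not required to grow; the interesting instances have
`nv n → ∞`. [cite: GrochowKumarSaksSaraf2017, Open Question 3, p.11] locator: paper:arxiv-1701.01717 p0010.txt:L24 -/
def openQuestion3 (Λ : ∀ m : ℕ, Set (MvPolynomial (Fin m) k)) : Prop :=
  ∃ (nv : ℕ → ℕ) (φ : ∀ n, Computability.Complexity.CNF (Fin (nv n))),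
    (∀ n, Computability.Complexity.CNF.IsWidthLE 3 (φ n) ∧
      ¬ Computability.Complexity.CNF.Satisfiable (φ n)) ∧
    ∀ n, ImageHits (cnfEquations (k := k) (φ n)) (Λ ((φ n).length + nv n))

end GeometricIPS

end Literature.Barriers.ValiantsHypothesis.GKSS2017

namespace Literature.Barriers.ValiantsHypothesis

/-- **GKSS Theorem 1** under the cell's flat load-bearing name `GKSS2017_thm1` (alias of
`GKSS2017.isSuccinctHittingSetFor_iff_not_exists_isNaturalAgainst`: for a presentation `Λ(n)` and
a class `Γ` of meta-polynomial families over an infinite integral domain, `Λ(n)` is a succinct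
hitting set against `Γ` iff no property is `Γ`-natural against `Λ`).
[cite: GrochowKumarSaksSaraf2017, Thm. 1, p.8] locator: paper:arxiv-1701.01717 p0007.txt:L42 -/
theorem GKSS2017_thm1 {k : Type*} [CommRing k] [IsDomain k] [Infinite k] {v : ℕ → ℕ}
    (M : ∀ n, Set (Fin (v n) →₀ ℕ)) (Λ : ∀ n, Set (MvPolynomial (Fin (v n)) k))
    (Γ : Set (∀ n, MvPolynomial (M n) k)) :
    GKSS2017.IsSuccinctHittingSetFor k M Λ Γ ↔ ¬ ∃ C, GKSS2017.IsNaturalAgainst k M Γ Λ C :=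
  GKSS2017.isSuccinctHittingSetFor_iff_not_exists_isNaturalAgainst M Λ Γ

end Literature.Barriers.ValiantsHypothesis
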